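import Literature.Algebra.Homology.HyperExtExactFunctor
import HarnessLib

/-!
# Hyper-Ext groups: functoriality in the source object

`Literature/Algebra/Homology/HyperExt.lean` defines `HyperExt X K n = Hom_{D(C)}(X[0], K⟦n⟧)` with
its functoriality `HyperExt.map` in the complex `K`. This file adds the (contravariant)
functoriality in the SOURCE object `X` — precomposition with `g[0]` for `g : X' ⟶ X` — which Mathlib
has for `Ext` as `Abelian.Ext.mk₀ g |>.comp`:

* `HyperExt.comap K n g : HyperExt X K n →+ HyperExt X' K n`, `comap_id`, `comap_comp`,
  `comap_zero_hom`;
* it commutes with everything defined by POSTcomposition: `map_comap` (functoriality in `K`),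
  `delta_comap` (connecting homomorphisms of short exact sequences of complexes), and with exact
  functors, `mapExactFunctor_comap` (`HyperExtExactFunctor.lean`);
* `comapEquivOfIso K n e : HyperExt X K n ≃+ HyperExt X' K n` for an isomorphism `e : X ≅ X'`.

## Why

Hypercohomology is `HyperExt ℤ K n` for the constant sheaf `ℤ`; an exact functor `j⁻¹` between
sheaf categories sends `ℤ_X` to an object only ISOMORPHIC to `ℤ_U`, and `comapEquivOfIso` moves
`HyperExt (j⁻¹ℤ_X) (j⁻¹K) n` to `HyperExt ℤ_U (j⁻¹K) n` compatibly with `map` and `delta`.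

## References

* C. A. Weibel, *An introduction to homological algebra*, CUP 1994, Def. 10.7.1 (hyperext is a
  bifunctor on the derived category). [Weibel1994]
-/

universe w w' v v' u u'

open CategoryTheory Limits DerivedCategory

namespace Literature.Algebra.Homology

namespace HyperExt

variable {C : Type u} [Category.{v} C] [Abelian C] {X X' X'' : C} {K L : CochainComplex C ℤ}
  [HasHyperExt.{w} X K] [HasHyperExt.{w} X' K] [HasHyperExt.{w} X'' K]
  [HasHyperExt.{w} X L] [HasHyperExt.{w} X' L] {n : ℤ}

set_option backward.isDefEq.respectTransparency false

variable (K n) in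
/-- **Contravariant functoriality of hyper-Ext in the source**: the map
`HyperExt X K n →+ HyperExt X' K n` induced by `g : X' ⟶ X` (precomposition with `g[0]` in the
derived category; `Hom_{D(C)}(-, K⟦n⟧)` is a functor). [cite: Weibel1994, Def. 10.7.1] -/
noncomputable def comap (g : X' ⟶ X) : HyperExt.{w} X K n →+ HyperExt.{w} X' K n :=
  letI := HasDerivedCategory.standard C
  AddMonoidHom.mk' (fun x => homAddEquiv.symm ((singleFunctor C 0).map g ≫ homAddEquiv x))
    (fun x y => by rw [map_add, Preadditive.comp_add, map_add])

/-- `comap` is precomposition with `g[0]` in the (constructed) derived category. [folklore] -/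
theorem homAddEquiv_comap (g : X' ⟶ X) (x : HyperExt.{w} X K n) :
    letI := HasDerivedCategory.standard C
    homAddEquiv (comap K n g x) = (singleFunctor C 0).map g ≫ homAddEquiv x :=
  AddEquiv.apply_symm_apply _ _

/-- `comap` of the identity. [folklore] -/
@[simp]
theorem comap_id (x : HyperExt.{w} X K n) : comap K n (𝟙 X) x = x := by
  apply homAddEquiv.injective
  rw [homAddEquiv_comap, CategoryTheory.Functor.map_id, Category.id_comp]

/-- `comap` is compatible with composition (contravariantly). [folklore] -/
theorem comap_comp (g' : X'' ⟶ X') (g : X' ⟶ X) (x : HyperExt.{w} X K n) :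
    comap K n (g' ≫ g) x = comap K n g' (comap K n g x) := by
  apply homAddEquiv.injective
  rw [homAddEquiv_comap, homAddEquiv_comap, homAddEquiv_comap, CategoryTheory.Functor.map_comp,
    Category.assoc]

/-- `comap` of the zero morphism is zero. [folklore] -/
@[simp]
theorem comap_zero_hom (x : HyperExt.{w} X K n) : comap K n (0 : X' ⟶ X) x = 0 := by
  apply homAddEquiv.injective
  rw [homAddEquiv_comap, CategoryTheory.Functor.map_zero, Limits.zero_comp, map_zero]

/-- `comap` (in the source) commutes with `map` (in the complex). [folklore] -/
theorem map_comap (f : K ⟶ L) (g : X' ⟶ X) (x : HyperExt.{w} X K n) :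
    map f n (comap K n g x) = comap L n g (map f n x) := by
  letI := HasDerivedCategory.standard C
  apply homAddEquiv.injective
  rw [homAddEquiv_map, homAddEquiv_comap, homAddEquiv_comap, homAddEquiv_map, Category.assoc]

section LES

variable {S : ShortComplex (CochainComplex C ℤ)} (hS : S.ShortExact)
  [HasHyperExt.{w} X S.X₁] [HasHyperExt.{w} X S.X₃] [HasHyperExt.{w} X' S.X₁]
  [HasHyperExt.{w} X' S.X₃]

omit [HasHyperExt.{w} X K] [HasHyperExt.{w} X' K] in
/-- `comap` (in the source) commutes with the connecting homomorphisms of short exact sequences of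
complexes. [folklore] -/
theorem delta_comap (g : X' ⟶ X) (n₀ n₁ : ℤ) (h : n₀ + 1 = n₁) (x : HyperExt.{w} X S.X₃ n₀) :
    delta hS n₀ n₁ h (comap S.X₃ n₀ g x) = comap S.X₁ n₁ g (delta hS n₀ n₁ h x) := by
  letI := HasDerivedCategory.standard C
  apply homAddEquiv.injective
  rw [homAddEquiv_delta', homAddEquiv_comap, homAddEquiv_comap, homAddEquiv_delta', Category.assoc]

end LES

variable (K n) in
/-- An isomorphism `X ≅ X'` of sources induces `HyperExt X K n ≃+ HyperExt X' K n`. [folklore] -/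
noncomputable def comapEquivOfIso (e : X ≅ X') : HyperExt.{w} X K n ≃+ HyperExt.{w} X' K n :=
  { comap K n e.inv with
    invFun := comap K n e.hom
    left_inv := fun x => by
      change comap K n e.hom (comap K n e.inv x) = x
      rw [← comap_comp, e.hom_inv_id, comap_id]
    right_inv := fun x => by
      change comap K n e.inv (comap K n e.hom x) = x
      rw [← comap_comp, e.inv_hom_id, comap_id] }

/-- `comapEquivOfIso e` is `comap e.inv`. [folklore] -/
@[simp]
theorem comapEquivOfIso_apply (e : X ≅ X') (x : HyperExt.{w} X K n) :
    comapEquivOfIso K n e x = comap K n e.inv x :=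
  rfl

/-- The inverse of `comapEquivOfIso e` is `comap e.hom`. [folklore] -/
@[simp]
theorem comapEquivOfIso_symm_apply (e : X ≅ X') (x : HyperExt.{w} X' K n) :
    (comapEquivOfIso K n e).symm x = comap K n e.hom x :=
  rfl

section ExactFunctor

variable {D : Type u'} [Category.{v'} D] [Abelian D]
  (F : C ⥤ D) [F.Additive] [PreservesFiniteLimits F] [PreservesFiniteColimits F]
  [HasHyperExt.{w'} (F.obj X) ((F.mapHomologicalComplex (ComplexShape.up ℤ)).obj K)]
  [HasHyperExt.{w'} (F.obj X') ((F.mapHomologicalComplex (ComplexShape.up ℤ)).obj K)]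

omit [HasHyperExt.{w} X'' K] in
/-- `mapExactFunctor` (along an exact functor `F`) commutes with `comap` (in the source):
`F(x ∘ g) = F(x) ∘ F(g)` (naturality of `Functor.mapDerivedCategorySingleFunctor`). [folklore] -/
theorem mapExactFunctor_comap (g : X' ⟶ X) (x : HyperExt.{w} X K n) :
    mapExactFunctor F n (comap K n g x) = comap _ n (F.map g) (mapExactFunctor F n x) := by
  letI := HasDerivedCategory.standard C
  letI := HasDerivedCategory.standard D
  apply homAddEquiv.injective
  rw [homAddEquiv_mapExactFunctor, homAddEquiv_comap, homAddEquiv_comap,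
    homAddEquiv_mapExactFunctor]
  simp only [ShiftedHom.map, Functor.map_comp, Category.assoc]
  have := (F.mapDerivedCategorySingleFunctor 0).inv.naturality g
  simp only [Functor.comp_map] at this
  rw [← reassoc_of% this]

end ExactFunctor

end HyperExt

end Literature.Algebra.Homology
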